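import Summits.PneNP.PneNP.Theorems.ConvexRankGatesConvexGateBlindExactLiftingTriangleMonoHeavy

/-!
# Triangle instance — the MONO-HEAVINESS calculus, II: never-heavy atoms and ε-uniform blindness (lead c6)

Support file for crux `ConvexGateBlind` (stmt-PneNP-10680), line `xor-door-perfect-completeness`, open stub
`stub_exactLifting`; sequel of `…TriangleMonoHeavy` (the heavy-atom theorem: at a balanced colouring `x`, every
combination `monoCount x · − ε = ∑_l u_l · v_l` with `u ≥ 0`, `ε > 0` has a Mono-heavy term, `v_l(Mono_x) > v_l(Non_x)`).

* §3  **Never-heavy classes.**  A non-negative function of TWO-DIRECTIONAL shape — `f(a,b) + h(a,d)`, `f(a,b) + h(b,d)`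
  or `f(a,d) + h(b,d)` — is heavy at NO balanced colouring (`heav_nonpos_of_twoDir`: at a fixed shared coordinate of
  colour `c`, summing `v ≥ 0` over the other-coloured vertices of the two remaining blocks isolates `t/2` times the
  bichromatic masses of the two tables, `key_ineq_a/b/d`).  The class contains every non-negative combination of lines
  of two directions, in particular every line.  An INTERACTION-FREE non-negative function `f(a,b) + g(b,d) + h(a,d)`
  vanishing on one whole plane (`a = π`, `b = π` or `d = π`) is two-directional
  (`twoDir_of_interactionFree_of_plane_vanishing`: on the plane the identity makes one table additively separable).
* §4  **ε-uniform blindness** (`no_factorisation_of_twoDir`, `no_factorisation_of_plane_vanishing`, and the registered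
  form `triangle_twoDir_blind`): for even `t ≥ 2` and EVERY `ε > 0` there is no non-negative factorisation of
  `M_t − εJ`, with ANY number of terms, all of whose atoms are two-directional — in particular none by non-negative
  combinations of lines of two directions per atom, none by interaction-free atoms each vanishing on a plane of its own.
  The line factorisation of `M_t` (`ε = 0`, `3t²` terms) is of this form, so the statement sits exactly on the strict
  side and does not degrade as `ε → 0⁺`: the atoms absorbing `−ε` must jointly meet all `3t` planes and carry 2-D
  interaction on every plane, for every `ε > 0`.  Earlier statements on the instance are `ε`-dependent
  (`…TriangleDegreeTwoBlind`: `ε ≤ 12/(t+8)`; Theorem A) or restrict supports to single lines (`…TriangleLine`) or rows to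
  a neighbourhood of the line pattern (Theorem B).

Nothing here is cited; everything is elementary.
-/

set_option linter.dupNamespace false -- `Summit.PneNP.PneNP.…`: summit = sub-problem (D-0017)

namespace Summit.PneNP.PneNP.Theorems.XorDoor.TriLine.Heavy

open Finset

noncomputable section

variable {t : ℕ} {x : Col t}

/-! ## §3 Never-heavy classes of atoms -/

/-- The three TWO-DIRECTIONAL shapes of a function on `Tri t`: a sum of two tables sharing one coordinate. -/
def TwoDir (v : Tri t → ℝ) : Prop :=
  (∃ f h : Fin t → Fin t → ℝ, ∀ a b d, v (a, b, d) = f a b + h a d) ∨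
  (∃ f h : Fin t → Fin t → ℝ, ∀ a b d, v (a, b, d) = f a b + h b d) ∨
  (∃ f h : Fin t → Fin t → ℝ, ∀ a b d, v (a, b, d) = f a d + h b d)

/-- positivity bookkeeping for the shared-`a` shape: at a fixed `a` of colour `c`, summing `v ≥ 0` over the
`b, d` of the other colour isolates the bichromatic masses of `f(a,·)` and `h(a,·)` -/
lemma key_ineq_a (hx : Balanced x) {v : Tri t → ℝ} (hnn : ∀ w, 0 ≤ v w) (f h : Fin t → Fin t → ℝ)
    (hv : ∀ a b d, v (a, b, d) = f a b + h a d) (a : Fin t) :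
    0 ≤ (t : ℝ) / 2 * (∑ b, (if x.1 a = x.2.1 b then (0 : ℝ) else 1) * f a b +
      ∑ d, (if x.1 a = x.2.2 d then (0 : ℝ) else 1) * h a d) := by
  have hB : ∑ b, (if x.1 a = x.2.1 b then (0 : ℝ) else 1) = t / 2 := hx.2.1.sum_ind (x.1 a)
  have hD : ∑ d, (if x.1 a = x.2.2 d then (0 : ℝ) else 1) = t / 2 := hx.2.2.sum_ind (x.1 a)
  have h0 : 0 ≤ ∑ b, ∑ d, (if x.1 a = x.2.1 b then (0 : ℝ) else 1) *
      (if x.1 a = x.2.2 d then (0 : ℝ) else 1) * v (a, b, d) := by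
    refine sum_nonneg fun b _ => sum_nonneg fun d _ => mul_nonneg (mul_nonneg ?_ ?_) (hnn _)
    all_goals split_ifs <;> norm_num
  have hexp : ∑ b, ∑ d, (if x.1 a = x.2.1 b then (0 : ℝ) else 1) *
      (if x.1 a = x.2.2 d then (0 : ℝ) else 1) * v (a, b, d)
      = (∑ b, (if x.1 a = x.2.1 b then (0 : ℝ) else 1) * f a b) * (∑ d, (if x.1 a = x.2.2 d then (0 : ℝ) else 1))
        + (∑ b, (if x.1 a = x.2.1 b then (0 : ℝ) else 1)) * ∑ d, (if x.1 a = x.2.2 d then (0 : ℝ) else 1) * h a d := by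
    rw [sum_mul_sum, sum_mul_sum, ← sum_add_distrib]
    refine sum_congr rfl fun b _ => ?_
    rw [← sum_add_distrib]
    refine sum_congr rfl fun d _ => ?_
    rw [hv]; ring
  rw [hexp, hB, hD] at h0
  linarith

/-- shared-`b` shape -/
lemma key_ineq_b (hx : Balanced x) {v : Tri t → ℝ} (hnn : ∀ w, 0 ≤ v w) (f h : Fin t → Fin t → ℝ)
    (hv : ∀ a b d, v (a, b, d) = f a b + h b d) (b : Fin t) :
    0 ≤ (t : ℝ) / 2 * (∑ a, (if x.2.1 b = x.1 a then (0 : ℝ) else 1) * f a b +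
      ∑ d, (if x.2.1 b = x.2.2 d then (0 : ℝ) else 1) * h b d) := by
  have hA : ∑ a, (if x.2.1 b = x.1 a then (0 : ℝ) else 1) = t / 2 := hx.1.sum_ind (x.2.1 b)
  have hD : ∑ d, (if x.2.1 b = x.2.2 d then (0 : ℝ) else 1) = t / 2 := hx.2.2.sum_ind (x.2.1 b)
  have h0 : 0 ≤ ∑ a, ∑ d, (if x.2.1 b = x.1 a then (0 : ℝ) else 1) *
      (if x.2.1 b = x.2.2 d then (0 : ℝ) else 1) * v (a, b, d) := by
    refine sum_nonneg fun a _ => sum_nonneg fun d _ => mul_nonneg (mul_nonneg ?_ ?_) (hnn _)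
    all_goals split_ifs <;> norm_num
  have hexp : ∑ a, ∑ d, (if x.2.1 b = x.1 a then (0 : ℝ) else 1) *
      (if x.2.1 b = x.2.2 d then (0 : ℝ) else 1) * v (a, b, d)
      = (∑ a, (if x.2.1 b = x.1 a then (0 : ℝ) else 1) * f a b) * (∑ d, (if x.2.1 b = x.2.2 d then (0 : ℝ) else 1))
        + (∑ a, (if x.2.1 b = x.1 a then (0 : ℝ) else 1)) * ∑ d, (if x.2.1 b = x.2.2 d then (0 : ℝ) else 1) * h b d := by
    rw [sum_mul_sum, sum_mul_sum, ← sum_add_distrib]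
    refine sum_congr rfl fun a _ => ?_
    rw [← sum_add_distrib]
    refine sum_congr rfl fun d _ => ?_
    rw [hv]; ring
  rw [hexp, hA, hD] at h0
  linarith

/-- shared-`d` shape -/
lemma key_ineq_d (hx : Balanced x) {v : Tri t → ℝ} (hnn : ∀ w, 0 ≤ v w) (f h : Fin t → Fin t → ℝ)
    (hv : ∀ a b d, v (a, b, d) = f a d + h b d) (d : Fin t) :
    0 ≤ (t : ℝ) / 2 * (∑ a, (if x.2.2 d = x.1 a then (0 : ℝ) else 1) * f a d +
      ∑ b, (if x.2.2 d = x.2.1 b then (0 : ℝ) else 1) * h b d) := by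
  have hA : ∑ a, (if x.2.2 d = x.1 a then (0 : ℝ) else 1) = t / 2 := hx.1.sum_ind (x.2.2 d)
  have hB : ∑ b, (if x.2.2 d = x.2.1 b then (0 : ℝ) else 1) = t / 2 := hx.2.1.sum_ind (x.2.2 d)
  have h0 : 0 ≤ ∑ a, ∑ b, (if x.2.2 d = x.1 a then (0 : ℝ) else 1) *
      (if x.2.2 d = x.2.1 b then (0 : ℝ) else 1) * v (a, b, d) := by
    refine sum_nonneg fun a _ => sum_nonneg fun b _ => mul_nonneg (mul_nonneg ?_ ?_) (hnn _)
    all_goals split_ifs <;> norm_num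
  have hexp : ∑ a, ∑ b, (if x.2.2 d = x.1 a then (0 : ℝ) else 1) *
      (if x.2.2 d = x.2.1 b then (0 : ℝ) else 1) * v (a, b, d)
      = (∑ a, (if x.2.2 d = x.1 a then (0 : ℝ) else 1) * f a d) * (∑ b, (if x.2.2 d = x.2.1 b then (0 : ℝ) else 1))
        + (∑ a, (if x.2.2 d = x.1 a then (0 : ℝ) else 1)) * ∑ b, (if x.2.2 d = x.2.1 b then (0 : ℝ) else 1) * h b d := by
    rw [sum_mul_sum, sum_mul_sum, ← sum_add_distrib]
    refine sum_congr rfl fun a _ => ?_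
    rw [← sum_add_distrib]
    refine sum_congr rfl fun b _ => ?_
    rw [hv]; ring
  rw [hexp, hA, hB] at h0
  linarith

/-- an `if`-indicator written the other way round -/
lemma ite_eq_comm' (p q : Bool) : (if p = q then (0 : ℝ) else 1) = (if q = p then (0 : ℝ) else 1) := by
  by_cases h : p = q
  · rw [if_pos h, if_pos h.symm]
  · rw [if_neg h, if_neg (fun h' => h h'.symm)]

/-- shared-`a` shape is never heavy -/
lemma heav_nonpos_of_twoDir_a (hx : Balanced x) {v : Tri t → ℝ} (hnn : ∀ w, 0 ≤ v w)
    (f h : Fin t → Fin t → ℝ) (hv : ∀ a b d, v (a, b, d) = f a b + h a d) : heav x v ≤ 0 := by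
  rw [heav_eq_sum3]
  have hsplit : ∀ a, ∑ b, ∑ d, sgn x (a, b, d) * v (a, b, d)
      = -(t : ℝ) * (∑ b, (if x.1 a = x.2.1 b then (0 : ℝ) else 1) * f a b +
          ∑ d, (if x.1 a = x.2.2 d then (0 : ℝ) else 1) * h a d) := by
    intro a
    have e1 : ∑ b, ∑ d, sgn x (a, b, d) * v (a, b, d)
        = ∑ b, ∑ d, sgn x (a, b, d) * f a b + ∑ b, ∑ d, sgn x (a, b, d) * h a d := by
      rw [← sum_add_distrib]
      refine sum_congr rfl fun b _ => ?_
      rw [← sum_add_distrib]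
      refine sum_congr rfl fun d _ => ?_
      rw [hv]; ring
    have e2 : ∑ b, ∑ d, sgn x (a, b, d) * f a b = ∑ b, (-(t : ℝ) * (if x.1 a = x.2.1 b then 0 else 1)) * f a b := by
      refine sum_congr rfl fun b _ => ?_
      rw [← sum_mul, sum_sgn_line12 hx]
    have e3 : ∑ b, ∑ d, sgn x (a, b, d) * h a d = ∑ d, (-(t : ℝ) * (if x.1 a = x.2.2 d then 0 else 1)) * h a d := by
      rw [sum_comm]
      refine sum_congr rfl fun d _ => ?_
      rw [← sum_mul, sum_sgn_line13 hx]
    rw [e1, e2, e3, mul_add, mul_sum, mul_sum]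
    congr 1 <;> exact sum_congr rfl fun _ _ => by ring
  simp_rw [hsplit]
  rw [← mul_sum]
  have hT : (0 : ℝ) ≤ t := Nat.cast_nonneg t
  have hin : 0 ≤ ∑ a, (∑ b, (if x.1 a = x.2.1 b then (0 : ℝ) else 1) * f a b +
      ∑ d, (if x.1 a = x.2.2 d then (0 : ℝ) else 1) * h a d) := by
    refine sum_nonneg fun a _ => ?_
    rcases Nat.eq_zero_or_pos t with h0 | hpos
    · subst h0; exact absurd a.2 (Nat.not_lt_zero _)
    · have hk := key_ineq_a hx hnn f h hv a
      have : (0 : ℝ) < t / 2 := by positivity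
      exact (mul_nonneg_iff_of_pos_left this).1 hk
  nlinarith

/-- shared-`b` shape is never heavy -/
lemma heav_nonpos_of_twoDir_b (hx : Balanced x) {v : Tri t → ℝ} (hnn : ∀ w, 0 ≤ v w)
    (f h : Fin t → Fin t → ℝ) (hv : ∀ a b d, v (a, b, d) = f a b + h b d) : heav x v ≤ 0 := by
  rw [heav_eq_sum3, sum_comm]
  have hsplit : ∀ b, ∑ a, ∑ d, sgn x (a, b, d) * v (a, b, d)
      = -(t : ℝ) * (∑ a, (if x.2.1 b = x.1 a then (0 : ℝ) else 1) * f a b +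
          ∑ d, (if x.2.1 b = x.2.2 d then (0 : ℝ) else 1) * h b d) := by
    intro b
    have e1 : ∑ a, ∑ d, sgn x (a, b, d) * v (a, b, d)
        = ∑ a, ∑ d, sgn x (a, b, d) * f a b + ∑ a, ∑ d, sgn x (a, b, d) * h b d := by
      rw [← sum_add_distrib]
      refine sum_congr rfl fun a _ => ?_
      rw [← sum_add_distrib]
      refine sum_congr rfl fun d _ => ?_
      rw [hv]; ring
    have e2 : ∑ a, ∑ d, sgn x (a, b, d) * f a b = ∑ a, (-(t : ℝ) * (if x.2.1 b = x.1 a then 0 else 1)) * f a b := by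
      refine sum_congr rfl fun a _ => ?_
      rw [← sum_mul, sum_sgn_line12 hx, ite_eq_comm']
    have e3 : ∑ a, ∑ d, sgn x (a, b, d) * h b d = ∑ d, (-(t : ℝ) * (if x.2.1 b = x.2.2 d then 0 else 1)) * h b d := by
      rw [sum_comm]
      refine sum_congr rfl fun d _ => ?_
      rw [← sum_mul, sum_sgn_line23 hx]
    rw [e1, e2, e3, mul_add, mul_sum, mul_sum]
    congr 1 <;> exact sum_congr rfl fun _ _ => by ring
  simp_rw [hsplit]
  rw [← mul_sum]
  have hT : (0 : ℝ) ≤ t := Nat.cast_nonneg t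
  have hin : 0 ≤ ∑ b, (∑ a, (if x.2.1 b = x.1 a then (0 : ℝ) else 1) * f a b +
      ∑ d, (if x.2.1 b = x.2.2 d then (0 : ℝ) else 1) * h b d) := by
    refine sum_nonneg fun b _ => ?_
    rcases Nat.eq_zero_or_pos t with h0 | hpos
    · subst h0; exact absurd b.2 (Nat.not_lt_zero _)
    · have hk := key_ineq_b hx hnn f h hv b
      have : (0 : ℝ) < t / 2 := by positivity
      exact (mul_nonneg_iff_of_pos_left this).1 hk
  nlinarith

/-- shared-`d` shape is never heavy -/
lemma heav_nonpos_of_twoDir_d (hx : Balanced x) {v : Tri t → ℝ} (hnn : ∀ w, 0 ≤ v w)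
    (f h : Fin t → Fin t → ℝ) (hv : ∀ a b d, v (a, b, d) = f a d + h b d) : heav x v ≤ 0 := by
  rw [heav_eq_sum3]
  have hcomm : ∑ a, ∑ b, ∑ d, sgn x (a, b, d) * v (a, b, d) = ∑ d, ∑ a, ∑ b, sgn x (a, b, d) * v (a, b, d) := by
    have hin : ∀ a, ∑ b, ∑ d, sgn x (a, b, d) * v (a, b, d) = ∑ d, ∑ b, sgn x (a, b, d) * v (a, b, d) :=
      fun a => sum_comm
    simp_rw [hin]
    exact sum_comm
  rw [hcomm]
  have hsplit : ∀ d, ∑ a, ∑ b, sgn x (a, b, d) * v (a, b, d)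
      = -(t : ℝ) * (∑ a, (if x.2.2 d = x.1 a then (0 : ℝ) else 1) * f a d +
          ∑ b, (if x.2.2 d = x.2.1 b then (0 : ℝ) else 1) * h b d) := by
    intro d
    have e1 : ∑ a, ∑ b, sgn x (a, b, d) * v (a, b, d)
        = ∑ a, ∑ b, sgn x (a, b, d) * f a d + ∑ a, ∑ b, sgn x (a, b, d) * h b d := by
      rw [← sum_add_distrib]
      refine sum_congr rfl fun a _ => ?_
      rw [← sum_add_distrib]
      refine sum_congr rfl fun b _ => ?_
      rw [hv]; ring
    have e2 : ∑ a, ∑ b, sgn x (a, b, d) * f a d = ∑ a, (-(t : ℝ) * (if x.2.2 d = x.1 a then 0 else 1)) * f a d := by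
      refine sum_congr rfl fun a _ => ?_
      rw [← sum_mul, sum_sgn_line13 hx, ite_eq_comm']
    have e3 : ∑ a, ∑ b, sgn x (a, b, d) * h b d = ∑ b, (-(t : ℝ) * (if x.2.2 d = x.2.1 b then 0 else 1)) * h b d := by
      rw [sum_comm]
      refine sum_congr rfl fun b _ => ?_
      rw [← sum_mul, sum_sgn_line23 hx, ite_eq_comm']
    rw [e1, e2, e3, mul_add, mul_sum, mul_sum]
    congr 1 <;> exact sum_congr rfl fun _ _ => by ring
  simp_rw [hsplit]
  rw [← mul_sum]
  have hT : (0 : ℝ) ≤ t := Nat.cast_nonneg t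
  have hin : 0 ≤ ∑ d, (∑ a, (if x.2.2 d = x.1 a then (0 : ℝ) else 1) * f a d +
      ∑ b, (if x.2.2 d = x.2.1 b then (0 : ℝ) else 1) * h b d) := by
    refine sum_nonneg fun d _ => ?_
    rcases Nat.eq_zero_or_pos t with h0 | hpos
    · subst h0; exact absurd d.2 (Nat.not_lt_zero _)
    · have hk := key_ineq_d hx hnn f h hv d
      have : (0 : ℝ) < t / 2 := by positivity
      exact (mul_nonneg_iff_of_pos_left this).1 hk
  nlinarith

/-- **Two-directional non-negative atoms are never heavy** (at any balanced colouring). -/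
theorem heav_nonpos_of_twoDir (hx : Balanced x) {v : Tri t → ℝ} (hnn : ∀ w, 0 ≤ v w) (hv : TwoDir v) :
    heav x v ≤ 0 := by
  rcases hv with ⟨f, h, hv⟩ | ⟨f, h, hv⟩ | ⟨f, h, hv⟩
  · exact heav_nonpos_of_twoDir_a hx hnn f h hv
  · exact heav_nonpos_of_twoDir_b hx hnn f h hv
  · exact heav_nonpos_of_twoDir_d hx hnn f h hv

/-- `v` vanishes identically on one of the `3t` planes. -/
def VanishesOnPlane (v : Tri t → ℝ) : Prop :=
  (∃ π, ∀ b d, v (π, b, d) = 0) ∨ (∃ π, ∀ a d, v (a, π, d) = 0) ∨ (∃ π, ∀ a b, v (a, b, π) = 0)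

/-- **An interaction-free function vanishing on a plane is two-directional**: on the plane `a = π` the identity
`f(π,b) + g(b,d) + h(π,d) = 0` makes `g` additively separable, and similarly for the other two directions. -/
theorem twoDir_of_interactionFree_of_plane_vanishing {v : Tri t → ℝ} (f g h : Fin t → Fin t → ℝ)
    (hv : ∀ a b d, v (a, b, d) = f a b + g b d + h a d) (hpl : VanishesOnPlane v) : TwoDir v := by
  rcases hpl with ⟨π, hπ⟩ | ⟨π, hπ⟩ | ⟨π, hπ⟩
  · refine Or.inl ⟨fun a b => f a b - f π b, fun a d => h a d - h π d, fun a b d => ?_⟩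
    have h0 := hπ b d
    rw [hv] at h0
    rw [hv]; linarith
  · refine Or.inr (Or.inl ⟨fun a b => f a b - f a π, fun b d => g b d - g π d, fun a b d => ?_⟩)
    have h0 := hπ a d
    rw [hv] at h0
    rw [hv]; linarith
  · refine Or.inr (Or.inr ⟨fun a d => h a d - h a π, fun b d => g b d - g b π, fun a b d => ?_⟩)
    have h0 := hπ a b
    rw [hv] at h0
    rw [hv]; linarith

/-! ## §4 ε-uniform blindness -/

/-- **No strict factorisation by two-directional atoms** (one balanced row suffices; any number of terms; every
`ε > 0`). -/
theorem no_factorisation_of_twoDir (ht : 1 ≤ t) (hx : Balanced x) {ε : ℝ} (hε : 0 < ε) {D : ℕ}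
    (u : Fin D → ℝ) (v : Fin D → Tri t → ℝ) (hu : ∀ l, 0 ≤ u l) (hnn : ∀ l w, 0 ≤ v l w)
    (hshape : ∀ l, TwoDir (v l)) (hrow : ∀ w, (monoCount x w : ℝ) - ε = ∑ l, u l * v l w) : False := by
  obtain ⟨l, -, hl⟩ := exists_monoHeavy_term ht hx hε u v hu hrow
  exact absurd hl (not_lt.2 (heav_nonpos_of_twoDir hx (hnn l) (hshape l)))

/-- **No strict factorisation by interaction-free atoms each vanishing on a plane of its own.** -/
theorem no_factorisation_of_plane_vanishing (ht : 1 ≤ t) (hx : Balanced x) {ε : ℝ} (hε : 0 < ε) {D : ℕ}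
    (u : Fin D → ℝ) (v : Fin D → Tri t → ℝ) (hu : ∀ l, 0 ≤ u l) (hnn : ∀ l w, 0 ≤ v l w)
    (hIF : ∀ l, ∃ f g h : Fin t → Fin t → ℝ, ∀ a b d, v l (a, b, d) = f a b + g b d + h a d)
    (hpl : ∀ l, VanishesOnPlane (v l)) (hrow : ∀ w, (monoCount x w : ℝ) - ε = ∑ l, u l * v l w) : False := by
  refine no_factorisation_of_twoDir ht hx hε u v hu hnn (fun l => ?_) hrow
  obtain ⟨f, g, h, hv⟩ := hIF l
  exact twoDir_of_interactionFree_of_plane_vanishing f g h hv (hpl l)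

/-- the comparison colouring of a block: the first `t/2` vertices `true` -/
def halfCol (t : ℕ) (ht : 1 ≤ t) : Fin t → Bool := fun a => decide (a < ⟨t / 2, Nat.div_lt_self ht one_lt_two⟩)

/-- the comparison colouring of a block is balanced when `t` is even -/
lemma balBlock_halfCol (ht : 1 ≤ t) (he : Even t) : BalBlock (halfCol t ht) := by
  have hcls : cls (halfCol t ht) true = Finset.Iio ⟨t / 2, Nat.div_lt_self ht one_lt_two⟩ := by
    ext a
    simp [cls, halfCol, Finset.mem_Iio]
  have hcard : #(cls (halfCol t ht) true) = t / 2 := by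
    rw [hcls, Fin.card_Iio]
  have hsum := card_cls_add_card_cls_not (halfCol t ht) true
  simp only [Bool.not_true] at hsum
  obtain ⟨k, hk⟩ := he
  unfold BalBlock
  omega

/-- an even number of vertices per block admits a balanced colouring -/
lemma exists_balanced (ht : 1 ≤ t) (he : Even t) : ∃ x : Col t, Balanced x :=
  ⟨(halfCol t ht, halfCol t ht, halfCol t ht),
    ⟨balBlock_halfCol ht he, balBlock_halfCol ht he, balBlock_halfCol ht he⟩⟩

/-- **ε-uniform blindness of the triangle instance to two-directional atoms** (registered form).  For even `t ≥ 2`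
and EVERY `ε > 0`, the matrix `M_t − εJ` (`M_t[x,w] = monoCount x w`) has no non-negative factorisation
`M_t[x,w] − ε = ∑_{l<D} U x l · V l w`, with any number `D` of terms, in which every column atom `V l` is
two-directional (in particular: a non-negative combination of lines of two directions; an interaction-free
non-negative function vanishing on some plane).  The line factorisation of `M_t` itself (`ε = 0`, `D = 3t²`) is of
this form, so the statement is exactly about the strict side, and it does not degrade as `ε → 0⁺`. -/
theorem triangle_twoDir_blind : ∀ t : ℕ, 2 ≤ t → Even t → ∀ ε : ℝ, 0 < ε → ∀ D : ℕ, ∀ (U : Col t → Fin D → ℝ) (V : Fin D → Tri t → ℝ), (∀ x l, 0 ≤ U x l) → (∀ l w, 0 ≤ V l w) → (∀ l, TwoDir (V l)) → ¬ ∀ x w, (monoCount x w : ℝ) - ε = ∑ l, U x l * V l w := by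
  intro t ht he ε hε D U V hU hV hshape hfact
  have h1 : 1 ≤ t := le_trans (by norm_num) ht
  obtain ⟨x, hx⟩ := exists_balanced h1 he
  exact no_factorisation_of_twoDir h1 hx hε (U x) V (hU x) hV hshape (hfact x)

end

end Summit.PneNP.PneNP.Theorems.XorDoor.TriLine.Heavy
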